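import Summits.CriticalPhenomena.SAWScalingLimit.Theorems.SAWDefectDecoherenceObservableToSLERGateTransferHexagon
import HarnessLib

/-!
# Skew hexagons: the continuum carriers of lattice hexagons and their limits (piece (G1-hex) of stub T2b″)

Crux `SAWDevelopingMap.ObservableToSLE` (stmt-CriticalPhenomena-10472), line `six-class-type-ladder`,
stub T2b″ `stub_carvedReduction_squeezeSolid`.  Landing target:
`Summits/CriticalPhenomena/SAWScalingLimit/Theorems/SAWDevelopingMapObservableToSLETypeLadderCarvedReductionSqueezeHexagons.lean`
(`--supports stmt-CriticalPhenomena-10472`).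

Items (G1)/(G3) of the repaired squeeze follow the `≤ 2N` rescaled level hexagons `contHex (δ_k) t r`
of the carved domains along a subsequence.  A rescaled (and translated) lattice hexagon is a SKEW
HEXAGON `{z | ∀ i, α i ≤ skewCoord i z ≤ β i}` — the intersection of three slabs in the three zigzag-row
directions — with six real parameters (`contHex_eq_skewHex`, `mem_skewHex_sub_iff`), so Blaschke
selection for them is just the selection of convergent parameters, and everything the squeeze needs
about the limits is parameter bookkeeping, proved here:

* `isClosed_skewHex`, `norm_le_of_mem_skewHex` (closed, bounded), `skewHex_mono`;
* `isOpen_skewHexStrict`, `skewHex_shrink_subset_interior` — the `ε`-shrunken hexagon lies in the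
  interior;
* `eventually_skewHex_sandwich` — if the parameters converge, eventually
  `hex(α + ε, β - ε) ⊆ hex(α_k, β_k) ⊆ hex(α - ε, β + ε)` (the shrunken limit hexagon is PERSISTENTLY
  inside the moving hexagons — persistently removed — and the moving hexagons stay in the thickened
  limit);
* `exists_pos_disjoint_skewHex_thicken` — a compact set missing the limit hexagon misses some
  thickening of it (so compacts of the limit carved domain are eventually carved);
* `mem_hexBall_iff_hexCenter_mem_contHex` — the lattice shadow of `contHex δ t r` is exactly
  `hexBall t r`.

Registered: `stub_carvedReduction_skewHexagons` (= `eventually_skewHex_sandwich`).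
-/

noncomputable section

open scoped Topology
open Filter Set Metric
open Literature.Probability.LatticeModels (HexVertex hexGraph hexCenter Site)
open Literature.Probability.RandomPlanarGeometry

namespace Summit.CriticalPhenomena.SAWScalingLimit.Theorems.ObservableToSLE.TypeLadder

open Summit.CriticalPhenomena.SAWScalingLimit.Theorems.ObservableToSLER.BridgeGate

/-! ### Skew coordinates are real-linear and continuous -/

/-- The skew coordinates are additive. -/
theorem skewCoord_add (i : Fin 3) (z w : ℂ) : skewCoord i (z + w) = skewCoord i z + skewCoord i w := by
  fin_cases i <;> simp [skewCoord] <;> ring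

/-- The skew coordinates are odd. -/
theorem skewCoord_neg (i : Fin 3) (z : ℂ) : skewCoord i (-z) = -skewCoord i z := by
  fin_cases i <;> simp [skewCoord] <;> ring

/-- The skew coordinates are homogeneous under real scalars. -/
theorem skewCoord_real_mul (i : Fin 3) (t : ℝ) (z : ℂ) : skewCoord i ((t : ℂ) * z) = t * skewCoord i z := by
  fin_cases i <;> simp [skewCoord] <;> ring

/-- The skew coordinates are continuous. -/
theorem continuous_skewCoord (i : Fin 3) : Continuous (skewCoord i) := by
  have h : skewCoord i = fun z : ℂ =>
      ![2 * z.im / Real.sqrt 3, z.re - z.im / Real.sqrt 3, z.re + z.im / Real.sqrt 3] i := rfl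
  rw [h]
  fin_cases i <;> simp <;> fun_prop

/-- A point is controlled by its skew coordinates: `‖z‖ ≤ |skewCoord 1 z| + |skewCoord 2 z| + |skewCoord 0 z|`
(`re z = (skew₁ + skew₂)/2`, `im z = (√3/2) skew₀`; cf. `BridgeGate.norm_le_skewCoord`). -/
theorem norm_le_abs_skewCoord_sum (z : ℂ) :
    ‖z‖ ≤ |skewCoord 1 z| + |skewCoord 2 z| + |skewCoord 0 z| := by
  have hs0 : 0 < Real.sqrt 3 := Real.sqrt_pos.2 (by norm_num)
  have hs3 : Real.sqrt 3 * Real.sqrt 3 = 3 := Real.mul_self_sqrt (by norm_num)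
  have hre : z.re = (skewCoord 1 z + skewCoord 2 z) / 2 := by simp [skewCoord]
  have him : z.im = Real.sqrt 3 / 2 * skewCoord 0 z := by
    simp [skewCoord]
  have h1 : ‖z‖ ≤ |z.re| + |z.im| := Complex.norm_le_abs_re_add_abs_im z
  have h2 : |z.re| ≤ (|skewCoord 1 z| + |skewCoord 2 z|) / 2 := by
    rw [hre, abs_div, abs_two]
    exact div_le_div_of_nonneg_right (abs_add_le _ _) (by norm_num)
  have h3 : |z.im| ≤ |skewCoord 0 z| := by
    rw [him, abs_mul, abs_of_pos (by positivity)]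
    have hs : Real.sqrt 3 / 2 ≤ 1 := by
      rw [div_le_one (by norm_num : (0:ℝ) < 2)]
      have := Real.sqrt_le_sqrt (show (3:ℝ) ≤ 4 by norm_num)
      rwa [show (4:ℝ) = 2 ^ 2 by norm_num, Real.sqrt_sq (by norm_num : (0:ℝ) ≤ 2)] at this
    nlinarith [abs_nonneg (skewCoord 0 z)]
  nlinarith [abs_nonneg (skewCoord 1 z), abs_nonneg (skewCoord 2 z)]

/-! ### Skew hexagons -/

/-- **The continuum hexagon is a skew hexagon**: for `0 < δ`,
`contHex δ c n = {z | ∀ i, δ (rowCoord i c - n) ≤ skewCoord i z ≤ δ (rowCoord i c + n + 1)}`. -/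
theorem contHex_eq_skewHex {δ : ℝ} (hδ : 0 < δ) (c : HexVertex) (n : ℕ) :
    contHex δ c n = {z : ℂ | ∀ i : Fin 3, δ * ((rowCoord i c : ℝ) - n) ≤ skewCoord i z ∧
      skewCoord i z ≤ δ * ((rowCoord i c : ℝ) + n + 1)} := by
  ext z
  simp only [contHex, mem_setOf_eq]
  have hdiv : ∀ i, skewCoord i (z / δ) = skewCoord i z / δ := by
    intro i
    rw [div_eq_inv_mul, show ((δ : ℂ))⁻¹ = ((δ⁻¹ : ℝ) : ℂ) by push_cast; ring, skewCoord_real_mul]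
    ring
  refine forall_congr' fun i => ?_
  rw [hdiv, le_div_iff₀ hδ, div_le_iff₀ hδ]
  constructor <;> rintro ⟨h1, h2⟩ <;> constructor <;> linarith

/-- **Translating a skew hexagon**: `z ∈ hex(α, β) - τ` (i.e. `z + τ ∈ hex(α, β)`) iff
`∀ i, α i - skewCoord i τ ≤ skewCoord i z ≤ β i - skewCoord i τ`. -/
theorem mem_skewHex_sub_iff (α β : Fin 3 → ℝ) (τ z : ℂ) :
    (∀ i : Fin 3, α i ≤ skewCoord i (z + τ) ∧ skewCoord i (z + τ) ≤ β i) ↔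
      ∀ i : Fin 3, α i - skewCoord i τ ≤ skewCoord i z ∧ skewCoord i z ≤ β i - skewCoord i τ := by
  refine forall_congr' fun i => ?_
  rw [skewCoord_add]
  constructor <;> rintro ⟨h1, h2⟩ <;> constructor <;> linarith

/-- Skew hexagons are closed. -/
theorem isClosed_skewHex (α β : Fin 3 → ℝ) :
    IsClosed {z : ℂ | ∀ i : Fin 3, α i ≤ skewCoord i z ∧ skewCoord i z ≤ β i} := by
  have : {z : ℂ | ∀ i : Fin 3, α i ≤ skewCoord i z ∧ skewCoord i z ≤ β i} =
      ⋂ i : Fin 3, {z | α i ≤ skewCoord i z} ∩ {z | skewCoord i z ≤ β i} := by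
    ext z; simp
  rw [this]
  exact isClosed_iInter fun i => (isClosed_le continuous_const (continuous_skewCoord i)).inter
    (isClosed_le (continuous_skewCoord i) continuous_const)

/-- Points of a skew hexagon are bounded by its parameters. -/
theorem norm_le_of_mem_skewHex {α β : Fin 3 → ℝ} {z : ℂ}
    (hz : ∀ i : Fin 3, α i ≤ skewCoord i z ∧ skewCoord i z ≤ β i) :
    ‖z‖ ≤ (|α 1| + |β 1|) + (|α 2| + |β 2|) + (|α 0| + |β 0|) := by
  have key : ∀ i, |skewCoord i z| ≤ |α i| + |β i| := by
    intro i
    obtain ⟨h1, h2⟩ := hz i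
    rw [abs_le]
    constructor <;> linarith [neg_abs_le (α i), le_abs_self (β i), abs_nonneg (α i), abs_nonneg (β i)]
  linarith [norm_le_abs_skewCoord_sum z, key 0, key 1, key 2]

/-- Skew hexagons are compact. -/
theorem isCompact_skewHex (α β : Fin 3 → ℝ) :
    IsCompact {z : ℂ | ∀ i : Fin 3, α i ≤ skewCoord i z ∧ skewCoord i z ≤ β i} :=
  Metric.isCompact_of_isClosed_isBounded (isClosed_skewHex α β)
    ((Metric.isBounded_closedBall (x := (0 : ℂ))
      (r := (|α 1| + |β 1|) + (|α 2| + |β 2|) + (|α 0| + |β 0|))).subset fun _ hz =>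
      mem_closedBall_zero_iff.2 (norm_le_of_mem_skewHex hz))

/-- Skew hexagons are monotone in their parameters. -/
theorem skewHex_mono {α β α' β' : Fin 3 → ℝ} (hα : ∀ i, α' i ≤ α i) (hβ : ∀ i, β i ≤ β' i) :
    {z : ℂ | ∀ i : Fin 3, α i ≤ skewCoord i z ∧ skewCoord i z ≤ β i} ⊆
      {z : ℂ | ∀ i : Fin 3, α' i ≤ skewCoord i z ∧ skewCoord i z ≤ β' i} :=
  fun _ hz i => ⟨(hα i).trans (hz i).1, (hz i).2.trans (hβ i)⟩

/-- The strict skew hexagon is open. -/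
theorem isOpen_skewHexStrict (α β : Fin 3 → ℝ) :
    IsOpen {z : ℂ | ∀ i : Fin 3, α i < skewCoord i z ∧ skewCoord i z < β i} := by
  have : {z : ℂ | ∀ i : Fin 3, α i < skewCoord i z ∧ skewCoord i z < β i} =
      ⋂ i : Fin 3, {z | α i < skewCoord i z} ∩ {z | skewCoord i z < β i} := by
    ext z; simp
  rw [this]
  exact isOpen_iInter_of_finite fun i => (isOpen_lt continuous_const (continuous_skewCoord i)).inter
    (isOpen_lt (continuous_skewCoord i) continuous_const)

/-- **The `ε`-shrunken hexagon lies in the interior.** -/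
theorem skewHex_shrink_subset_interior (α β : Fin 3 → ℝ) {ε : ℝ} (hε : 0 < ε) :
    {z : ℂ | ∀ i : Fin 3, α i + ε ≤ skewCoord i z ∧ skewCoord i z ≤ β i - ε} ⊆
      interior {z : ℂ | ∀ i : Fin 3, α i ≤ skewCoord i z ∧ skewCoord i z ≤ β i} := by
  refine (interior_maximal (fun z hz i => ⟨(hz i).1.le, (hz i).2.le⟩) (isOpen_skewHexStrict α β)).trans'
    fun z hz i => ⟨?_, ?_⟩
  · linarith [(hz i).1]
  · linarith [(hz i).2]

/-- **The sandwich along converging parameters.**  If `αk → α` and `βk → β` (coordinatewise), then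
for every `ε > 0`, eventually `hex(α + ε, β - ε) ⊆ hex(αk, βk) ⊆ hex(α - ε, β + ε)`. -/
theorem eventually_skewHex_sandwich {αk βk : ℕ → Fin 3 → ℝ} {α β : Fin 3 → ℝ}
    (hα : ∀ i, Tendsto (fun k => αk k i) atTop (𝓝 (α i))) (hβ : ∀ i, Tendsto (fun k => βk k i) atTop (𝓝 (β i)))
    {ε : ℝ} (hε : 0 < ε) :
    ∀ᶠ k in atTop,
      {z : ℂ | ∀ i : Fin 3, α i + ε ≤ skewCoord i z ∧ skewCoord i z ≤ β i - ε} ⊆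
          {z : ℂ | ∀ i : Fin 3, αk k i ≤ skewCoord i z ∧ skewCoord i z ≤ βk k i} ∧
        {z : ℂ | ∀ i : Fin 3, αk k i ≤ skewCoord i z ∧ skewCoord i z ≤ βk k i} ⊆
          {z : ℂ | ∀ i : Fin 3, α i - ε ≤ skewCoord i z ∧ skewCoord i z ≤ β i + ε} := by
  have hαe : ∀ i, ∀ᶠ k in atTop, dist (αk k i) (α i) < ε := fun i => Metric.tendsto_nhds.1 (hα i) ε hε
  have hβe : ∀ i, ∀ᶠ k in atTop, dist (βk k i) (β i) < ε := fun i => Metric.tendsto_nhds.1 (hβ i) ε hε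
  have hall : ∀ᶠ k in atTop, ∀ i, dist (αk k i) (α i) < ε ∧ dist (βk k i) (β i) < ε := by
    rw [eventually_all]
    exact fun i => (hαe i).and (hβe i)
  filter_upwards [hall] with k hk
  constructor
  · refine skewHex_mono (fun i => ?_) (fun i => ?_)
    · have := (hk i).1; rw [Real.dist_eq, abs_lt] at this; linarith
    · have := (hk i).2; rw [Real.dist_eq, abs_lt] at this; linarith
  · refine skewHex_mono (fun i => ?_) (fun i => ?_)
    · have := (hk i).1; rw [Real.dist_eq, abs_lt] at this; linarith
    · have := (hk i).2; rw [Real.dist_eq, abs_lt] at this; linarith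

/-- **A compact set missing a skew hexagon misses a thickening of it.**  (The thickenings
`hex(α - ε, β + ε)`, `ε ↓ 0`, are closed and decrease to `hex(α, β)`.) -/
theorem exists_pos_disjoint_skewHex_thicken {K : Set ℂ} (hK : IsCompact K) {α β : Fin 3 → ℝ}
    (hdisj : Disjoint K {z : ℂ | ∀ i : Fin 3, α i ≤ skewCoord i z ∧ skewCoord i z ≤ β i}) :
    ∃ ε > (0 : ℝ), Disjoint K {z : ℂ | ∀ i : Fin 3, α i - ε ≤ skewCoord i z ∧ skewCoord i z ≤ β i + ε} := by
  -- the continuous "excess" function is positive on `K`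
  set f : ℂ → ℝ := fun z => Finset.univ.sup' Finset.univ_nonempty
    fun i : Fin 3 => max (α i - skewCoord i z) (skewCoord i z - β i) with hf
  have hfc : Continuous f := by
    refine Continuous.finset_sup'_apply _ fun i _ => ?_
    exact ((continuous_const.sub (continuous_skewCoord i)).max ((continuous_skewCoord i).sub continuous_const))
  have hfpos : ∀ z ∈ K, 0 < f z := by
    intro z hz
    by_contra hle
    push Not at hle
    refine (Set.disjoint_left.1 hdisj hz) fun i => ?_
    have hi : max (α i - skewCoord i z) (skewCoord i z - β i) ≤ f z :=
      Finset.le_sup' (fun i : Fin 3 => max (α i - skewCoord i z) (skewCoord i z - β i)) (Finset.mem_univ i)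
    constructor <;> linarith [le_max_left (α i - skewCoord i z) (skewCoord i z - β i),
      le_max_right (α i - skewCoord i z) (skewCoord i z - β i)]
  rcases K.eq_empty_or_nonempty with rfl | hKne
  · exact ⟨1, one_pos, by simp⟩
  · obtain ⟨z₀, hz₀, hmin⟩ := hK.exists_isMinOn hKne hfc.continuousOn
    refine ⟨f z₀ / 2, by linarith [hfpos z₀ hz₀], Set.disjoint_left.2 fun z hz hzh => ?_⟩
    have h1 : f z₀ ≤ f z := hmin hz
    have h2 : f z ≤ f z₀ / 2 := by
      refine Finset.sup'_le _ _ fun i _ => max_le ?_ ?_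
      · linarith [(hzh i).1]
      · linarith [(hzh i).2]
    linarith [hfpos z₀ hz₀]

/-- **The lattice shadow of a continuum hexagon is the lattice hexagon**: for `0 < δ`, the face `v`
has its rescaled centre in `contHex δ t r` iff `v ∈ hexBall t r`. -/
theorem mem_hexBall_iff_hexCenter_mem_contHex {δ : ℝ} (hδ : 0 < δ) (t v : HexVertex) (r : ℕ) :
    v ∈ hexBall t r ↔ (δ : ℂ) * hexCenter v ∈ contHex δ t r := by
  rw [contHex_eq_skewHex hδ]
  simp only [hexBall, mem_setOf_eq, skewCoord_real_mul]
  refine forall_congr' fun i => ?_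
  rw [abs_le, mul_le_mul_iff_right₀ hδ, mul_le_mul_iff_right₀ hδ]
  have h3 := rowCoord_add_third_le_skewCoord i v
  have h4 := skewCoord_le_rowCoord_add_two_thirds i v
  constructor
  · rintro ⟨ha, hb⟩
    have ha' : ((rowCoord i t : ℤ) : ℝ) - r ≤ rowCoord i v := by exact_mod_cast (show rowCoord i t - (r : ℤ) ≤ rowCoord i v by linarith)
    have hb' : ((rowCoord i v : ℤ) : ℝ) ≤ rowCoord i t + r := by exact_mod_cast (show rowCoord i v ≤ rowCoord i t + (r : ℤ) by linarith)
    constructor <;> linarith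
  · rintro ⟨ha, hb⟩
    constructor
    · by_contra hlt
      push Not at hlt
      have h5 : ((rowCoord i v : ℤ) : ℝ) ≤ rowCoord i t - r - 1 := by
        exact_mod_cast (show rowCoord i v ≤ rowCoord i t - (r : ℤ) - 1 by linarith)
      linarith
    · by_contra hlt
      push Not at hlt
      have h5 : ((rowCoord i t : ℤ) : ℝ) + r + 1 ≤ rowCoord i v := by
        exact_mod_cast (show rowCoord i t + (r : ℤ) + 1 ≤ rowCoord i v by linarith)
      linarith

/-- **Registered sub-goal `stub_carvedReduction_skewHexagons`** (crux item stmt-CriticalPhenomena-10472,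
stub T2b″ `stub_carvedReduction_squeezeSolid`, piece (G1-hex) THE SANDWICH OF SKEW HEXAGONS ALONG
CONVERGING PARAMETERS): registry form of `eventually_skewHex_sandwich`. -/
theorem stub_carvedReduction_skewHexagons :
    ∀ (αk βk : ℕ → Fin 3 → ℝ) (α β : Fin 3 → ℝ) (ε : ℝ),
      (∀ i, Tendsto (fun k => αk k i) atTop (𝓝 (α i))) → (∀ i, Tendsto (fun k => βk k i) atTop (𝓝 (β i))) →
      0 < ε →
      ∀ᶠ k in atTop,
        {z : ℂ | ∀ i : Fin 3, α i + ε ≤ skewCoord i z ∧ skewCoord i z ≤ β i - ε} ⊆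
            {z : ℂ | ∀ i : Fin 3, αk k i ≤ skewCoord i z ∧ skewCoord i z ≤ βk k i} ∧
          {z : ℂ | ∀ i : Fin 3, αk k i ≤ skewCoord i z ∧ skewCoord i z ≤ βk k i} ⊆
            {z : ℂ | ∀ i : Fin 3, α i - ε ≤ skewCoord i z ∧ skewCoord i z ≤ β i + ε} :=
  fun _ _ _ _ _ hα hβ hε => eventually_skewHex_sandwich hα hβ hε

end Summit.CriticalPhenomena.SAWScalingLimit.Theorems.ObservableToSLE.TypeLadder

end
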